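import Literature.Computability.AlgebraicComplexity.RectangularExponent
import Literature.Computability.AlgebraicComplexity.KroneckerRank
import HarnessLib

/-!
# `ω(a, b, c)` is invariant under permutations of `(a, b, c)` — proved

Topic `Literature/Computability/AlgebraicComplexity`.  Alman–Duan–Vassilevska Williams–Xu–Xu–Zhou,
*More asymmetry yields faster matrix multiplication* (SODA 2025, arXiv:2404.16349), §3.4:

> It is known that `ω(a,b,c) = ω(a,c,b) = ω(c,a,b)` so that the value remains the same for any
> permutation of the dimensions `a, b, c`.

For the tree's rank-form exponents `omegaRect K a b c = inf {β | R(⟨⌈n^a⌉, ⌈n^b⌉, ⌈n^c⌉⟩) = O(n^β)}`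
(`RectangularExponent.lean`) this is immediate from the invariance of the rank of the matrix
multiplication tensor under all permutations of its three formats, `R(⟨k,m,n⟩) = R(⟨n,k,m⟩) = … `
(Bläser 2013, Lemma 5.5 = `Blaser2013_lemma55`, `KroneckerRank.lean`): the defining sets of
admissible exponents coincide (`rectAdmissibleExponents_rotate`, `rectAdmissibleExponents_swap₂₃`),
hence so do the infima: `omegaRect_rotate` (`ω(a,b,c) = ω(b,c,a)`), `omegaRect_swap₂₃`
(`ω(a,b,c) = ω(a,c,b)`), `omegaRect_swap₁₂`, `omegaRect_swap₁₃`, and the printed sentence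
`advxxz2025_omegaRect_perm`.  (The special case `ω(1,p,1) = ω(1,1,p)` is `omegaRect_one_mid_one` of
`RectangularExponentBounds.lean`.)  Everything is proved; no definitions, no named facts.

## References

* J. Alman, R. Duan, V. Vassilevska Williams, Y. Xu, Z. Xu, R. Zhou, *More asymmetry yields faster
  matrix multiplication*, SODA 2025, arXiv:2404.16349, §3.4. [AlmanDuanVassilevskaWilliamsXuXuZhou2025]
* M. Bläser, *Fast Matrix Multiplication*, Theory of Computing Graduate Surveys 5 (2013), Lemma 5.5.
  [Blaser2013]
-/

noncomputable section

open Filter Asymptotics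

namespace Literature.Computability.AlgebraicComplexity

universe u

variable (K : Type u) [CommSemiring K]

/-- Cyclic rotation of the formats does not change the admissible exponents
(`R(⟨k,m,n⟩) = R(⟨m,n,k⟩)`, Bläser 2013, Lemma 5.5). [cite: Blaser2013, Lemma 5.5] -/
theorem rectAdmissibleExponents_rotate (a b c : ℝ) :
    rectAdmissibleExponents K a b c = rectAdmissibleExponents K b c a := by
  have hf : (fun n : ℕ =>
      (tensorRank (matMulTensor K (rectDim n a) (rectDim n b) (rectDim n c)) : ℝ)) =
      fun n : ℕ => (tensorRank (matMulTensor K (rectDim n b) (rectDim n c) (rectDim n a)) : ℝ) :=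
    funext fun n => by
      rw [(Blaser2013_lemma55 K (rectDim n a) (rectDim n b) (rectDim n c)).2.1]
  ext β
  simp only [rectAdmissibleExponents, Set.mem_setOf_eq, hf]

/-- Swapping the last two formats does not change the admissible exponents
(`R(⟨k,m,n⟩) = R(⟨k,n,m⟩)`, Bläser 2013, Lemma 5.5). [cite: Blaser2013, Lemma 5.5] -/
theorem rectAdmissibleExponents_swap₂₃ (a b c : ℝ) :
    rectAdmissibleExponents K a b c = rectAdmissibleExponents K a c b := by
  have hf : (fun n : ℕ =>
      (tensorRank (matMulTensor K (rectDim n a) (rectDim n b) (rectDim n c)) : ℝ)) =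
      fun n : ℕ => (tensorRank (matMulTensor K (rectDim n a) (rectDim n c) (rectDim n b)) : ℝ) :=
    funext fun n => by
      rw [(Blaser2013_lemma55 K (rectDim n a) (rectDim n b) (rectDim n c)).2.2.2.2]
  ext β
  simp only [rectAdmissibleExponents, Set.mem_setOf_eq, hf]

/-- **`ω(a, b, c) = ω(b, c, a)`.** [cite: AlmanDuanVassilevskaWilliamsXuXuZhou2025, §3.4] -/
theorem omegaRect_rotate (a b c : ℝ) : omegaRect K a b c = omegaRect K b c a := by
  unfold omegaRect
  rw [rectAdmissibleExponents_rotate]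

/-- **`ω(a, b, c) = ω(a, c, b)`.** [cite: AlmanDuanVassilevskaWilliamsXuXuZhou2025, §3.4] -/
theorem omegaRect_swap₂₃ (a b c : ℝ) : omegaRect K a b c = omegaRect K a c b := by
  unfold omegaRect
  rw [rectAdmissibleExponents_swap₂₃]

/-- **`ω(a, b, c) = ω(b, a, c)`.** [cite: AlmanDuanVassilevskaWilliamsXuXuZhou2025, §3.4] -/
theorem omegaRect_swap₁₂ (a b c : ℝ) : omegaRect K a b c = omegaRect K b a c := by
  rw [omegaRect_rotate, omegaRect_swap₂₃]

/-- **`ω(a, b, c) = ω(c, b, a)`.** [cite: AlmanDuanVassilevskaWilliamsXuXuZhou2025, §3.4] -/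
theorem omegaRect_swap₁₃ (a b c : ℝ) : omegaRect K a b c = omegaRect K c b a := by
  rw [omegaRect_swap₂₃, omegaRect_rotate]

/-- **ADVXXZ §3.4, as printed: "`ω(a,b,c) = ω(a,c,b) = ω(c,a,b)`, so that the value remains the same
for any permutation of the dimensions `a, b, c`"** (for the rank-form exponents `omegaRect`; the six
permutations are generated by the two displayed ones). [cite: AlmanDuanVassilevskaWilliamsXuXuZhou2025, §3.4] -/
theorem advxxz2025_omegaRect_perm (a b c : ℝ) :
    omegaRect K a b c = omegaRect K a c b ∧ omegaRect K a b c = omegaRect K c a b :=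
  ⟨omegaRect_swap₂₃ K a b c, by rw [omegaRect_rotate K c a b]⟩

end Literature.Computability.AlgebraicComplexity

end
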